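import Literature.Probability.LatticeModels.CircleWeightPathEstimator
import Literature.Probability.LatticeModels.VillainMMPInequality
import Literature.Probability.LatticeModels.VillainCircleMoments
import Literature.Probability.LatticeModels.UnitChainPushforward
import Literature.Probability.LatticeModels.GarbanSpencerXYLongRangeOrderProofs
import HarnessLib

/-!
# Long-range order of the Villain rotator on the torus `(ℤ/Lℤ)^d × ℤ/Mℤ`, `d ≥ 3`
# (Garban–Spencer 2022, Theorem 1.3 / Remark 1 / Remark 10, on periodic boxes)

For the Villain plane rotator `∏_{(s,μ)} v_β(θ_{s+e_μ} − θ_s) dθ` on the bond system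
`JCurrent.bondSystem d L M` of the space-time torus (`CircleWeightBondModel.lean`; the Fourier dual
of the homogeneous Villain current model, `VillainTorusWormRepresentation.lean`), `d ≥ 3`:

* `villain_torus_pairExpect_cosDiff_ge` — there is `β₁ = β₁(d) ≥ 1` such that for all `β ≥ β₁`, all
  `L, M ≥ 1` and all `x, y ∈ ℤ^d` with `16‖x − y‖₂² < L²`,
  `⟨cos(θ_{(πx,0)} − θ_{(πy,0)})⟩_{v_β} ≥ 1/2` (`π` the projection to `(ℤ/Lℤ)^d`).

The proof is Garban–Spencer's (arXiv:2109.01617, proof of Thm. 1.3, as formalised for the XY model in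
`GarbanSpencerXYLongRangeOrderProofs.lean`), run with the Villain weight: the deterministic estimate
`one_sub_pairExpect_one_cosDiff_le_of_mmp` (Nishimori gauge identity, path identity and estimator for
a general weight; the MMP inequality for the Villain weight — the tree's
`BondSystem.villainExpect_cosDiff_le_villainExpect_one` of `VillainMMPInequality.lean`, transported by
`rfl` to the `pairExpect (villainCircleWeight β)` vocabulary (`pairExpect_cosDiff_le_one_villain`); the
Villain moments `λ = e^{-1/(2β)}`, `λ⁻¹ ≤ 1 + 2/β`), applied ON THE TORUS to the push-forward
(`exists_unitChain_latticeBonds_to_torus`) of the tree's ball-path ensemble in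
`B((x+y)/2, 2‖x−y‖₂) ⊂ ℤ^d` (`BallPath.Frame.chainOf`, overlaps controlled by near-meetings with
exponential tails, `card_meetCount_ge_le`); the ball projects injectively into the torus because
`16‖x − y‖₂² < L²` (`torusProj_injOn_of_ball`). Constants: `c = 2(d+2)`, `β₁ = 192 c L_*` with `L_*`
the tail scale of `card_meetCount_ge_le`; then `1 − ⟨cos⟩ ≤ (48 c L_*/β)^{1/2} ≤ 1/2`.

Theorems only.

## References

* C. Garban, T. Spencer, J. Math. Phys. 63 (2022) 093302, arXiv:2109.01617: Theorem 1.3, Remark 1,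
  Remark 10, Lemma 2.5, proof of Theorem 1.3 Steps 1–2. [GarbanSpencer2022]
* J. Fröhlich, T. Spencer, Comm. Math. Phys. 83 (1982) 411–454 (long-range order of the Villain model
  in `d ≥ 3`, the statement; here obtained by the RP-free route of [GarbanSpencer2022]).
  [FrohlichSpencerCMP1982]
-/

noncomputable section

open MeasureTheory Finset
open scoped BigOperators

namespace Literature.Probability.LatticeModels

open BallPath DyadicWalk Trail

/-! ### The two Villain vocabularies agree -/

/-- The general-weight Gibbs weight of `CircleWeightBondModel` at the Villain weight IS the Villain
weight of `VillainDisorderedModel`: `pairWeight (villainCircleWeight K) = villainWeight K`. [folklore] -/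
theorem BondSystem.pairWeight_villainCircleWeight {V ι : Type*} [Fintype ι] (G : BondSystem V ι) (K : ℝ) :
    G.pairWeight (villainCircleWeight K) = G.villainWeight K := rfl

/-- `pairExpect (villainCircleWeight K) u f = villainExpect K u f` for every Borel structure on the
circle (the right-hand side is stated with the tree's global `Circle.instMeasurableSpace = borel Circle`,
to which any `[BorelSpace Circle]` instance is equal, `BorelSpace.measurable_eq`). [folklore] -/
theorem BondSystem.pairExpect_villainCircleWeight {V ι : Type*} [Fintype ι] [Fintype V]
    [m : MeasurableSpace Circle] [hm : BorelSpace Circle] (G : BondSystem V ι)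
    (K : ℝ) (u : ι → Circle) (f : (V → Circle) → ℝ) :
    G.pairExpect (villainCircleWeight K) u f = G.villainExpect K u f := by
  have h : m = borel Circle := hm.measurable_eq
  subst h
  simp only [BondSystem.pairExpect, BondSystem.villainExpect, BondSystem.pairPartitionFn,
    BondSystem.villainPartitionFn, BondSystem.pairWeight_villainCircleWeight]

/-- **MMP for the Villain weight in the `pairExpect` vocabulary**: quenched bond phases lower
`⟨cos(θ(x) − θ(y))⟩` (the tree's `villainExpect_cosDiff_le_villainExpect_one`, Garban–Spencer 2022
Remark 1 / Remark 10, transported by `pairExpect_villainCircleWeight`).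
[cite: GarbanSpencer2022, Remark 1, Remark 10 and Appendix Theorem 7.1] -/
theorem BondSystem.pairExpect_cosDiff_le_one_villain {V ι : Type*} [Fintype ι] [Fintype V]
    [MeasurableSpace Circle] [BorelSpace Circle] (G : BondSystem V ι) {K : ℝ} (hK : 0 < K)
    (u : ι → Circle) (x y : V) :
    G.pairExpect (villainCircleWeight K) u (cosDiff x y) ≤ G.pairExpect (villainCircleWeight K) 1 (cosDiff x y) := by
  rw [G.pairExpect_villainCircleWeight, G.pairExpect_villainCircleWeight]
  exact G.villainExpect_cosDiff_le_villainExpect_one hK u x y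

variable {d : ℕ} [MeasurableSpace Circle] [BorelSpace Circle]

/-- **Long-range order of the Villain rotator on the torus (`d ≥ 3`).** There is `β₁ = β₁(d) ≥ 1` such
that for all `β ≥ β₁`, all `L, M ≥ 1` and all `x, y ∈ ℤ^d` with `16‖x − y‖₂² < L²`, the Villain
rotator `∏_{(s,μ)} v_β(θ_{s+e_μ} − θ_s) dθ` on the bond system of `(ℤ/Lℤ)^d × ℤ/Mℤ` satisfies
`⟨cos(θ_{(πx,0)} − θ_{(πy,0)})⟩ ≥ 1/2` (Garban–Spencer's Theorem 1.3 with Remarks 1 and 10, run on the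
torus with the ball-path ensemble pushed forward from `ℤ^d`).
[cite: GarbanSpencer2022, Theorem 1.3 with Remark 1 and Remark 10] -/
theorem villain_torus_pairExpect_cosDiff_ge (hd : 3 ≤ d) :
    ∃ β₁ : ℝ, 1 ≤ β₁ ∧ ∀ β : ℝ, β₁ ≤ β → ∀ (L M : ℕ) [NeZero L] [NeZero M] (x y : Site d),
      16 * ∑ i, ((x i : ℝ) - (y i : ℝ)) ^ 2 < (L : ℝ) ^ 2 →
        1 / 2 ≤ (JCurrent.bondSystem d L M).pairExpect (villainCircleWeight β) 1
          (cosDiff ((Torus.proj L x, 0) : JCurrent.SpaceTimeSite d L M) ((Torus.proj L y, 0))) := by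
  obtain ⟨Ls, hLs, htail⟩ := card_meetCount_ge_le
  -- constants
  set c : ℕ := 2 * (d + 2) with hc
  have hc1 : (1 : ℝ) ≤ c := by rw [hc]; push_cast; linarith [show (0:ℝ) ≤ d from Nat.cast_nonneg d]
  have hLs1 : (1 : ℝ) ≤ Ls := by exact_mod_cast hLs
  refine ⟨192 * c * Ls, by nlinarith, ?_⟩
  intro β hβ L M _ _ x y hxy
  have hβ1 : (1 : ℝ) ≤ β := le_trans (by nlinarith) hβ
  have hβ0 : 0 < β := lt_of_lt_of_le one_pos hβ1
  have hβ16 : 16 * c * Ls ≤ β := le_trans (by nlinarith) hβ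
  set G' := JCurrent.bondSystem d L M with hG'
  set W := villainCircleWeight β with hWdef
  have hW : Continuous W := continuous_villainCircleWeight hβ0
  have hW0 : ∀ z, 0 < W z := villainCircleWeight_pos hβ0
  have hodd := integral_im_mul_villainCircleWeight (β := β) hβ0
  have hl : 0 < circleWeightMean W := circleWeightMean_villain_pos hβ0
  -- the trivial case `x = y`
  by_cases hne : x = y
  · subst hne
    have : (cosDiff ((Torus.proj L x, 0) : JCurrent.SpaceTimeSite d L M) ((Torus.proj L x, 0)) :
        (JCurrent.SpaceTimeSite d L M → Circle) → ℝ) = fun _ => 1 := funext fun θ => cosDiff_self _ θ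
    rw [this, G'.pairExpect_one hW hW0]
    norm_num
  -- frame, ball and ensemble in `ℤ^d`
  obtain ⟨F, rfl, rfl⟩ := Frame.exists_of_ne hd hne
  obtain ⟨Λ, hΛ⟩ := exists_ball_finset F.x F.y
  have hball : ∀ z : Site d, (∑ i, ((z i : ℝ) - ((F.x i : ℝ) + (F.y i : ℝ)) / 2) ^ 2) ≤
      4 * ∑ i, ((F.x i : ℝ) - (F.y i : ℝ)) ^ 2 → z ∈ Λ := fun z hz => (hΛ z).2 hz
  haveI : Nonempty F.Rnd := ⟨fun _ => 0⟩
  obtain ⟨ω₀⟩ := (inferInstance : Nonempty F.Rnd)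
  have hx : F.x ∈ Λ := hball _ (F.mem_ball_of_mem_verts ω₀ List.mem_cons_self)
  have hy : F.y ∈ Λ := hball _ (F.mem_ball_of_mem_verts ω₀ (by
    rw [← F.getLast_verts ω₀]; exact List.getLast_mem _))
  have hinj : Set.InjOn (Torus.proj (d := d) L) (Λ : Set (Site d)) :=
    torusProj_injOn_of_ball F.x F.y hxy Λ fun z hz => (hΛ z).1 hz
  set T : F.Rnd → (latticeBonds Λ).UnitChain (⟨F.x, hx⟩ : ↥Λ) ⟨F.y, hy⟩ := F.chainOf hx hy hball with hT
  -- push the ensemble forward to the torus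
  obtain ⟨T', hT'⟩ := exists_unitChain_latticeBonds_to_torus (M := M) Λ hinj T
  set w : F.Rnd → ℝ := fun _ => (Fintype.card F.Rnd : ℝ)⁻¹ with hw
  have hcard : (0 : ℝ) < Fintype.card F.Rnd := by exact_mod_cast Fintype.card_pos
  have hw0 : ∀ s, 0 ≤ w s := fun _ => by positivity
  have hw1 : ∑ s, w s = 1 := by
    rw [hw, Finset.sum_const, Finset.card_univ, nsmul_eq_mul, mul_inv_cancel₀ hcard.ne']
  -- the deterministic estimate on the torus
  have hmmp : ∀ u : JCurrent.Bond d L M → Circle, G'.pairExpect W u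
      (cosDiff ((Torus.proj L F.x, 0) : JCurrent.SpaceTimeSite d L M) ((Torus.proj L F.y, 0))) ≤
      G'.pairExpect W 1 (cosDiff ((Torus.proj L F.x, 0) : JCurrent.SpaceTimeSite d L M) ((Torus.proj L F.y, 0))) :=
    fun u => G'.pairExpect_cosDiff_le_one_villain hβ0 u _ _
  have hest := G'.one_sub_pairExpect_one_cosDiff_le_of_mmp hW hW0 hodd hl hmmp w hw0 hw1 T'
  simp only [hT'] at hest
  -- `κ = λ^{-2}`, `ρ = κ^c`
  set lam := circleWeightMean W with hlam
  have hlam1 : lam ≤ 1 := circleWeightMean_villain_le_one hβ0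
  set κ : ℝ := (lam ^ 2)⁻¹ with hκ
  have hκ1 : 1 ≤ κ := by
    rw [hκ, one_le_inv₀ (by positivity)]; exact pow_le_one₀ hl.le hlam1
  have hκle : κ ≤ (1 + 2 / β) ^ 2 := by
    have h := inv_circleWeightMean_villain_le hβ1
    rw [hκ, ← inv_pow]
    exact pow_le_pow_left₀ (by positivity) h 2
  set ρ : ℝ := κ ^ c with hρ
  have hρ1 : 1 ≤ ρ := one_le_pow₀ hκ1
  have hcβ : 2 * ((2 * c : ℕ) : ℝ) ≤ β := by push_cast; nlinarith
  have hcLβ : 2 * ((2 * c * Ls : ℕ) : ℝ) ≤ β := by push_cast; nlinarith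
  have hρle : ρ ≤ 1 + 8 * c / β := by
    calc ρ ≤ ((1 + 2 / β) ^ 2) ^ c := pow_le_pow_left₀ (by positivity) hκle c
      _ = (1 + 2 / β) ^ (2 * c) := by rw [← pow_mul]
      _ ≤ 1 + 4 * ((2 * c : ℕ) : ℝ) / β := one_add_two_div_pow_le hβ0 hcβ
      _ = 1 + 8 * c / β := by push_cast; ring
  have hρL : ρ ^ Ls ≤ 3 / 2 := by
    have h16 : 4 * ((2 * c * Ls : ℕ) : ℝ) / β ≤ 1 / 2 := by
      rw [div_le_iff₀ hβ0]; push_cast; nlinarith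
    calc ρ ^ Ls ≤ (((1 + 2 / β) ^ 2) ^ c) ^ Ls :=
          pow_le_pow_left₀ (by positivity) (pow_le_pow_left₀ (by positivity) hκle c) Ls
      _ = (1 + 2 / β) ^ (2 * c * Ls) := by rw [← pow_mul, ← pow_mul]; simp only [hc]; ring_nf
      _ ≤ 1 + 4 * ((2 * c * Ls : ℕ) : ℝ) / β := one_add_two_div_pow_le hβ0 hcLβ
      _ ≤ 3 / 2 := by linarith
  -- the overlap moment
  have hmom : ∑ s, ∑ s', w s * w s' * κ ^ (T s).overlap (T s') ≤ 1 + 6 * Ls * (ρ - 1) := by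
    have hpair : ∀ s s', κ ^ (T s).overlap (T s') ≤
        ρ ^ meetCount (DyadicWalk.M F.T F.T) 0 (F.T + 1) ((s, s') : Pair F.T F.T) := by
      intro s s'
      rw [hρ, ← pow_mul]
      exact pow_le_pow_right₀ hκ1 (by rw [hT]; exact F.overlap_chainOf_le hx hy hball s s')
    have htail' := htail F.T F.T (Nat.lt_two_pow_self).le
    have hmgf := sum_pow_le_of_tails (fun p : Pair F.T F.T => meetCount (DyadicWalk.M F.T F.T) 0 (F.T + 1) p) hLs
      (fun k => by simpa [DyadicWalk.cnt] using htail' k) hρ1 hρL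
    rw [Fintype.card_prod] at hmgf
    calc ∑ s, ∑ s', w s * w s' * κ ^ (T s).overlap (T s')
        ≤ ∑ s, ∑ s', w s * w s' * ρ ^ meetCount (DyadicWalk.M F.T F.T) 0 (F.T + 1) ((s, s') : Pair F.T F.T) :=
          Finset.sum_le_sum fun s _ => Finset.sum_le_sum fun s' _ =>
            mul_le_mul_of_nonneg_left (hpair s s') (mul_nonneg (hw0 s) (hw0 s'))
      _ = (Fintype.card F.Rnd : ℝ)⁻¹ ^ 2 * ∑ p : Pair F.T F.T, ρ ^ meetCount (DyadicWalk.M F.T F.T) 0 (F.T + 1) p := by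
          rw [Fintype.sum_prod_type, Finset.mul_sum]
          refine Finset.sum_congr rfl fun s _ => ?_
          rw [Finset.mul_sum]
          refine Finset.sum_congr rfl fun s' _ => ?_
          rw [hw]; ring
      _ ≤ (Fintype.card F.Rnd : ℝ)⁻¹ ^ 2 * ((1 + 6 * Ls * (ρ - 1)) * (Fintype.card F.Rnd * Fintype.card F.Rnd : ℕ)) :=
          mul_le_mul_of_nonneg_left hmgf (by positivity)
      _ = 1 + 6 * Ls * (ρ - 1) := by push_cast; field_simp
  -- conclusion
  have hfin : ∑ s, ∑ s', w s * w s' * κ ^ (T s).overlap (T s') - 1 ≤ (1 / 2) ^ 2 := by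
    have h192 : 48 * c * Ls / β ≤ 1 / 4 := by
      rw [div_le_iff₀ hβ0]; nlinarith
    calc ∑ s, ∑ s', w s * w s' * κ ^ (T s).overlap (T s') - 1 ≤ 6 * Ls * (ρ - 1) := by linarith
      _ ≤ 6 * Ls * (8 * c / β) := mul_le_mul_of_nonneg_left (by linarith) (by positivity)
      _ = 48 * c * Ls / β := by ring
      _ ≤ (1 / 2) ^ 2 := by norm_num; linarith
  have hsq := Real.sqrt_le_sqrt hfin
  rw [Real.sqrt_sq (by norm_num : (0 : ℝ) ≤ 1 / 2)] at hsq
  linarith [hest]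

end Literature.Probability.LatticeModels
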